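import Summits.BirchSwinnertonDyer.BirchSwinnertonDyer.Theorems.SignedLowerHalvesSprungLowerDivisibilityAtThreeKatoSporadicLedgerX8
import HarnessLib

/-!
# Crux `SprungLowerDivisibilityAtThree` (item stmt-BirchSwinnertonDyer-19875; x8 children 22569 `KatoFineLowerSporadicX8` / 23401
# `KatoSporadicPosLevelGivenHeldX8C`), line `chromatic-common-zeros`: THE DEPTH DOOR — a sporadic prime at least as deep as `3^a` at
# which the defect element is shallower than `3^a` is NOT a counterexample (card `Ideas/stub-katofinelowersporadic-k4-g4.md`, Plan A)

Cell `bsd-ssimc` (host), width seat `cruxlead-stmt-BirchSwinnertonDyer-19875-w3` (gen 9) under the 19875 LEAD; `--supports`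
stmt-BirchSwinnertonDyer-22569 `--as helper`; theorems only (no `def`, no named fact, no instance); closes NO item. Lands item «k4-g4 §A–§B» of
the stub-critic's idle helper queue (`STUB-PLAN-stub_katoFineLowerSporadic.md` v7 §D / v8 §D (2)); the card's graded Kurihara-digit bridge
(`GradedKolyvaginDefectX8`, declared XL there) is NOT typed here. HONEST FRAMING: a per-cell INSTRUMENT over the residue stub's own binders,
CONDITIONAL on the displayed named facts `h714`, `h716`, `h3` exactly like its socket `ClassX8.exists_katoSporadicDefect` (p-landed,
`…KatoSporadicLedgerX8`) and therefore exactly as keying-exposed as that socket (the binders `I, Cs, Cf` are the `γ`-keyed joint package —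
see the KEYING notes of the child skeletons and LEAD g6's `…TypedInputsInconsistent*` / `…GuardedPackageVacuity`); nothing about any curve
is computed; K_spor, R♮, K1, leaf X8 and BSD are NOT proved by anything here.

THE DOOR (card k4-g4 A.1, «assume the opposite»). On an X8 pair the socket gives ONE `j ≠ 0` with `ℓ_𝔭(I.H ⧸ Cs.Z) = ℓ_𝔭 Y.X + ℓ_𝔭 Λ/(j)`
and (`ℓ_𝔭(I.H ⧸ Cs.Z) ≤ ℓ_𝔭 Y.X ⟺ j ∉ 𝔭`) at every height-one `𝔭 ∌ 3`. Write `j = 3^m · g₀` and let `𝔭 = (f₀)`. If the body fails at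
`𝔭`, then `f₀ ∣ j`, hence (`3 ∉ 𝔭`, `𝔭` prime) `f₀ ∣ g₀`, hence `f₀(0) ∣ g₀(0)` in `ℤ₃` (`constantCoeff` is a ring map): a counterexample
prime is AT MOST AS DEEP AS THE DEFECT, `v₃(f₀(0)) ≤ v₃(g₀(0))`. Contrapositive = the door: `3^a ∣ f₀(0)` and `3^a ∤ g₀(0)` ⟹ the body of
`stub_katoFineLowerSporadic` / of K_spor at `(Y, 𝔭)` for EVERY fine dual datum `Y` — no zero location, no common-zero hypothesis.

* §1 `constantCoeff_dvd_of_dvd`, `not_mem_of_constantCoeff_depth` — the two-line algebra.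
* §2 `ClassX8.katoFineLowerAt_of_defectDepth (h714) (h716) (h3)` — the door over the stub's binders; `…_of_constantCoeff_ne_zero` — the free
  by-product at a prime `𝔭 = (f₀)` with `f₀(0) = 0` (e.g. `𝔭 = (T)`): the body holds as soon as `g₀(0) ≠ 0`.

References: card `Ideas/stub-katofinelowersporadic-k4-g4.md` Plan A (stub-ideation k4 g4; triage G32A §1–2 re-proved the algebra); [Kato2004Asterisque]
Conj. 12.10 (p. 224), §17.13 (p. 280); [Sprung2012] Thm. 7.14, 7.16 (p. 1504), Prop. 7.19 (p. 1505); [Washington1997] §7.1 (distinguished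
polynomials, constant terms); tree: `…KatoSporadicLedgerX8` (`ClassX8.exists_katoSporadicDefect`), `…KatoSporadicLedger` (`zeta_le_fine_iff_not_mem_of_eq_add`).
-/

set_option linter.dupNamespace false
set_option autoImplicit false

noncomputable section

open scoped Classical NumberField MatrixGroups ModularForm

open NumberField IsDedekindDomain CongruenceSubgroup WeierstrassCurve Field
  Literature.NumberTheory.EllipticCurves Literature.NumberTheory.EllipticCurves.ModularForms
  Literature.NumberTheory.EllipticCurves.ZpExtension Literature.NumberTheory.EllipticCurves.Sprung2017
  Literature.NumberTheory.EllipticCurves.Sprung2012 Literature.NumberTheory.EllipticCurves.Rank1Residual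
  Literature.NumberTheory.EllipticCurves.Kato2004 Literature.NumberTheory.EllipticCurves.Module

namespace Summit.BirchSwinnertonDyer.BirchSwinnertonDyer.Theorems.ChromaticCommonZeros

/-! ### §1 The two-line algebra: constant terms along divisibility, and the depth test -/

section Algebra

/-- `f ∣ g` in `R⟦X⟧` gives `f(0) ∣ g(0)` in `R` (`constantCoeff` is a ring homomorphism). [folklore] -/
theorem constantCoeff_dvd_of_dvd {R : Type*} [CommSemiring R] {f g : PowerSeries R} (h : f ∣ g) :
    PowerSeries.constantCoeff f ∣ PowerSeries.constantCoeff g :=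
  map_dvd PowerSeries.constantCoeff h

variable {p : ℕ} [Fact p.Prime]

/-- **The depth test.** At a prime `𝔭 = (f₀)` of `Λ = ℤ_p⟦T⟧` with `p ∉ 𝔭`, an element `j = p^m · g₀` whose `p`-free part is SHALLOWER than
the generator — `p^a ∣ f₀(0)` but `p^a ∤ g₀(0)` — does not lie in `𝔭`: otherwise `f₀ ∣ g₀` (`𝔭` prime, `p ∉ 𝔭`) and `f₀(0) ∣ g₀(0)`.
Card k4-g4 A.1. [folklore] [cite: Washington1997, §7.1] -/
theorem not_mem_of_constantCoeff_depth (𝔭 : PrimeSpectrum (IwasawaAlgebra p)) {f₀ g₀ j : IwasawaAlgebra p} {a m : ℕ}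
    (hf₀ : 𝔭.asIdeal = Ideal.span {f₀}) (hp𝔭 : (p : IwasawaAlgebra p) ∉ 𝔭.asIdeal)
    (hj : j = (p : IwasawaAlgebra p) ^ m * g₀)
    (hfa : (p : ℤ_[p]) ^ a ∣ PowerSeries.constantCoeff f₀) (hga : ¬ (p : ℤ_[p]) ^ a ∣ PowerSeries.constantCoeff g₀) :
    j ∉ 𝔭.asIdeal := by
  intro hjm
  have hg₀ : g₀ ∈ 𝔭.asIdeal := by
    rw [hj] at hjm
    rcases 𝔭.isPrime.mem_or_mem hjm with h | h
    · exact absurd (𝔭.isPrime.mem_of_pow_mem _ h) hp𝔭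
    · exact h
  rw [hf₀, Ideal.mem_span_singleton] at hg₀
  exact hga (hfa.trans (constantCoeff_dvd_of_dvd hg₀))

/-- The depth test at a prime whose generator has constant term `0` (e.g. `𝔭 = (T)`): `j = p^m · g₀ ∉ 𝔭` as soon as `g₀(0) ≠ 0`
(take `a = v_p(g₀(0)) + 1`; here directly: `f₀ ∣ g₀` forces `g₀(0) = 0`). [folklore] -/
theorem not_mem_of_constantCoeff_eq_zero_of_ne_zero (𝔭 : PrimeSpectrum (IwasawaAlgebra p)) {f₀ g₀ j : IwasawaAlgebra p} {m : ℕ}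
    (hf₀ : 𝔭.asIdeal = Ideal.span {f₀}) (hp𝔭 : (p : IwasawaAlgebra p) ∉ 𝔭.asIdeal)
    (hj : j = (p : IwasawaAlgebra p) ^ m * g₀)
    (hf0 : PowerSeries.constantCoeff f₀ = 0) (hg0 : PowerSeries.constantCoeff g₀ ≠ 0) :
    j ∉ 𝔭.asIdeal := by
  intro hjm
  have hg₀ : g₀ ∈ 𝔭.asIdeal := by
    rw [hj] at hjm
    rcases 𝔭.isPrime.mem_or_mem hjm with h | h
    · exact absurd (𝔭.isPrime.mem_of_pow_mem _ h) hp𝔭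
    · exact h
  rw [hf₀, Ideal.mem_span_singleton] at hg₀
  have h := constantCoeff_dvd_of_dvd hg₀
  rw [hf0, zero_dvd_iff] at h
  exact hg0 h

end Algebra

/-! ### §2 The door over the stub's binders -/

section Door

/-- **THE DEPTH DOOR over the binders of `stub_katoFineLowerSporadic` / `stub_katoFineLowerResidueIotaOffT`** (card k4-g4 Plan A.1, its
signature verbatim). On an X8 pair, in the setting of Sprung 2012 Thm. 2.2, for every newform `f`, period ratio `ϖ`, Sprung pair `(L♯, L♭)`,
every pinned `I` with joint ♯/♭ Coleman–Kato packages `Cs, Cf` (`Cs.Z = Cf.Z`): there is ONE `j ≠ 0` in `Λ` — the DEFECT ELEMENT of the socket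
`ClassX8.exists_katoSporadicDefect` — such that for every fine dual datum `Y`, every height-one `𝔭 ∌ 3` with generator `f₀`, and every
factorisation `j = 3^m · g₀`: if `3^a ∣ f₀(0)` and `3^a ∤ g₀(0)` for some `a`, then `ℓ_𝔭(I.H ⧸ Cs.Z) ≤ ℓ_𝔭 Y.X` (the body of K_spor at
`(Y, 𝔭)`). «A counterexample prime is at most as deep as the defect.» CONDITIONAL on `h714`, `h716`, `h3` (displayed) exactly like the socket,
and as keying-exposed as the socket. [cite: Kato2004Asterisque, Conj. 12.10 (p. 224), §17.13 (p. 280)]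
[cite: Sprung2012, Prop. 6.14 (p. 1498), Thm. 7.14, Thm. 7.16 (p. 1504), Prop. 7.19 (p. 1505)] [cite: GreenbergVatsal2000, Rem. 3.4]
[cite: Washington1997, §7.1] -/
theorem ClassX8.katoFineLowerAt_of_defectDepth (h714 : thm714_sharpFlatSelmerDual_finite_torsion)
    (h716 : thm716_sharpFlatCharIdeal_divisibility) (h3 : realPeriodRat_eq_unit_mul_plusPeriod_three)
    (W : WeierstrassCurve ℚ) [W.IsElliptic] [W.IsGloballyMinimal] (p : ℕ) [Fact p.Prime]
    [ContinuousSMul ℤ_[p] (W.tateModule p)] [Module.Free ℤ_[p] (W.tateModule p)]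
    [Module.Finite ℤ_[p] (W.tateModule p)]
    (hX : ClassX8 W p) (κ : ZpExtension ℚ p) (γ : Field.absoluteGaloisGroup ℚ)
    (hκ : κ.IsCyclotomic) (hγ : κ.IsTopGenerator γ) (hcv : IsCyclotomicVariable p γ)
    (v : HeightOneSpectrum (𝓞 ℚ)) (hv : (p : 𝓞 ℚ) ∈ v.asIdeal)
    (g : Field.absoluteGaloisGroup (v.adicCompletion ℚ))
    (hg : κ.IsTopGenerator (resGalOfEmb (closureEmb (K := ℚ) (v.adicCompletion ℚ)) g))
    (cneg : localPoints W (v.adicCompletion ℚ)) (c : ℕ → localPoints W (v.adicCompletion ℚ))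
    (hH : IsHondaSystem κ (closureEmb (K := ℚ) (v.adicCompletion ℚ)) W (W.frobeniusTrace p) g cneg c)
    (N : ℕ) (hN : NeZero N) (f : CuspForm (Gamma0 N) 2) (ϖ : ℚ) (Lsharp Lflat : IwasawaAlgebra p)
    (hf : IsNewformOf W f) (hϖ : (ϖ : ℝ) * W.realPeriodRat = plusPeriod f)
    (hSP : IsSprungPair f p (W.frobeniusTrace p) Lsharp Lflat)
    (I : Kato2004.IwasawaH1Data W p κ γ)
    (Cs : SharpFlatColemanKatoData W p f ϖ κ γ (closureEmb (K := ℚ) (v.adicCompletion ℚ)) (W.frobeniusTrace p) g c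
      Chroma.sharp I)
    (Cf : SharpFlatColemanKatoData W p f ϖ κ γ (closureEmb (K := ℚ) (v.adicCompletion ℚ)) (W.frobeniusTrace p) g c
      Chroma.flat I)
    (hZ : Cs.Z = Cf.Z) :
    ∃ j : IwasawaAlgebra p, j ≠ 0 ∧
      ∀ (Y : W.FineSelmerDualData κ γ) (𝔭 : PrimeSpectrum (IwasawaAlgebra p)), 𝔭.asIdeal.height = 1 →
        (p : IwasawaAlgebra p) ∉ 𝔭.asIdeal → ∀ (f₀ g₀ : IwasawaAlgebra p) (a m : ℕ),
        𝔭.asIdeal = Ideal.span {f₀} → j = (p : IwasawaAlgebra p) ^ m * g₀ →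
        (p : ℤ_[p]) ^ a ∣ PowerSeries.constantCoeff f₀ → ¬ (p : ℤ_[p]) ^ a ∣ PowerSeries.constantCoeff g₀ →
        Module.lengthAt (IwasawaAlgebra p) (I.H ⧸ Cs.Z) 𝔭 ≤ Module.lengthAt (IwasawaAlgebra p) Y.X 𝔭 := by
  obtain ⟨j, hj0, hj⟩ := ClassX8.exists_katoSporadicDefect h714 h716 h3 W p hX κ γ hκ hγ hcv v hv g hg cneg c hH N hN f ϖ
    Lsharp Lflat hf hϖ hSP I Cs Cf hZ
  refine ⟨j, hj0, fun Y 𝔭 h𝔭 hp𝔭 f₀ g₀ a m hf₀ hjg hfa hga => ?_⟩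
  exact (hj Y 𝔭 h𝔭 hp𝔭).2.mpr (not_mem_of_constantCoeff_depth 𝔭 hf₀ hp𝔭 hjg hfa hga)

/-- **The free by-product at a prime with `f₀(0) = 0`** (e.g. the augmentation prime `𝔭 = (T)`, the `(T)`-cell of the sibling item 22570):
with the same defect element `j = 3^m · g₀`, the body `ℓ_𝔭(I.H ⧸ Cs.Z) ≤ ℓ_𝔭 Y.X` holds at `𝔭 = (f₀)`, `f₀(0) = 0`, as soon as `g₀(0) ≠ 0`.
Same conditions as the door. [cite: Kato2004Asterisque, Conj. 12.10 (p. 224)] [cite: Sprung2012, Thm. 7.16 (p. 1504), Prop. 7.19 (p. 1505)] -/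
theorem ClassX8.katoFineLowerAt_of_defect_constantCoeff_ne_zero (h714 : thm714_sharpFlatSelmerDual_finite_torsion)
    (h716 : thm716_sharpFlatCharIdeal_divisibility) (h3 : realPeriodRat_eq_unit_mul_plusPeriod_three)
    (W : WeierstrassCurve ℚ) [W.IsElliptic] [W.IsGloballyMinimal] (p : ℕ) [Fact p.Prime]
    [ContinuousSMul ℤ_[p] (W.tateModule p)] [Module.Free ℤ_[p] (W.tateModule p)]
    [Module.Finite ℤ_[p] (W.tateModule p)]
    (hX : ClassX8 W p) (κ : ZpExtension ℚ p) (γ : Field.absoluteGaloisGroup ℚ)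
    (hκ : κ.IsCyclotomic) (hγ : κ.IsTopGenerator γ) (hcv : IsCyclotomicVariable p γ)
    (v : HeightOneSpectrum (𝓞 ℚ)) (hv : (p : 𝓞 ℚ) ∈ v.asIdeal)
    (g : Field.absoluteGaloisGroup (v.adicCompletion ℚ))
    (hg : κ.IsTopGenerator (resGalOfEmb (closureEmb (K := ℚ) (v.adicCompletion ℚ)) g))
    (cneg : localPoints W (v.adicCompletion ℚ)) (c : ℕ → localPoints W (v.adicCompletion ℚ))
    (hH : IsHondaSystem κ (closureEmb (K := ℚ) (v.adicCompletion ℚ)) W (W.frobeniusTrace p) g cneg c)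
    (N : ℕ) (hN : NeZero N) (f : CuspForm (Gamma0 N) 2) (ϖ : ℚ) (Lsharp Lflat : IwasawaAlgebra p)
    (hf : IsNewformOf W f) (hϖ : (ϖ : ℝ) * W.realPeriodRat = plusPeriod f)
    (hSP : IsSprungPair f p (W.frobeniusTrace p) Lsharp Lflat)
    (I : Kato2004.IwasawaH1Data W p κ γ)
    (Cs : SharpFlatColemanKatoData W p f ϖ κ γ (closureEmb (K := ℚ) (v.adicCompletion ℚ)) (W.frobeniusTrace p) g c
      Chroma.sharp I)
    (Cf : SharpFlatColemanKatoData W p f ϖ κ γ (closureEmb (K := ℚ) (v.adicCompletion ℚ)) (W.frobeniusTrace p) g c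
      Chroma.flat I)
    (hZ : Cs.Z = Cf.Z) :
    ∃ j : IwasawaAlgebra p, j ≠ 0 ∧
      ∀ (Y : W.FineSelmerDualData κ γ) (𝔭 : PrimeSpectrum (IwasawaAlgebra p)), 𝔭.asIdeal.height = 1 →
        (p : IwasawaAlgebra p) ∉ 𝔭.asIdeal → ∀ (f₀ g₀ : IwasawaAlgebra p) (m : ℕ),
        𝔭.asIdeal = Ideal.span {f₀} → j = (p : IwasawaAlgebra p) ^ m * g₀ →
        PowerSeries.constantCoeff f₀ = 0 → PowerSeries.constantCoeff g₀ ≠ 0 →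
        Module.lengthAt (IwasawaAlgebra p) (I.H ⧸ Cs.Z) 𝔭 ≤ Module.lengthAt (IwasawaAlgebra p) Y.X 𝔭 := by
  obtain ⟨j, hj0, hj⟩ := ClassX8.exists_katoSporadicDefect h714 h716 h3 W p hX κ γ hκ hγ hcv v hv g hg cneg c hH N hN f ϖ
    Lsharp Lflat hf hϖ hSP I Cs Cf hZ
  refine ⟨j, hj0, fun Y 𝔭 h𝔭 hp𝔭 f₀ g₀ m hf₀ hjg hf0 hg0 => ?_⟩
  exact (hj Y 𝔭 h𝔭 hp𝔭).2.mpr (not_mem_of_constantCoeff_eq_zero_of_ne_zero 𝔭 hf₀ hp𝔭 hjg hf0 hg0)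

end Door

end Summit.BirchSwinnertonDyer.BirchSwinnertonDyer.Theorems.ChromaticCommonZeros

end
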